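import Literature.AlgebraicGeometry.Modules.TorsionStable
import HarnessLib

/-!
# Extending sections of a torsion-free module across a closed subset, after multiplying by `𝓘ⁿ`

The affine-local core of "Deligne's formula" `Γ(X ∖ V(𝓘), M) = colimₙ Hom(𝓘ⁿ, M)` (Hartshorne II
Ex. 5.15 / III Ex. 3.7; EGA I 9.4.7 — the extension lemma invoked in step (iii) of the dévissage, EGA
III 3.1.3 / Görtz–Wedhorn I, Lemma 12.63 (iii)), in the form needed here. Setting: `M` affine-localizing
without `𝓘`-torsion (`Modules/TorsionStable`), an open `W₀` containing the principal opens `D(g)`,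
`g ∈ 𝓘(V)`, of every affine `V`, and a section `s ∈ Γ(W₀, M)`. An **extension of `a · s` to the
affine `V`** (`IsExtension`) is a section `x ∈ Γ(V, M)` with `x|_{D(g)} = a|_{D(g)} · s|_{D(g)}` for all
`g ∈ 𝓘(V)`.

* `IsExtension.unique` — extensions are unique (`M` has no `𝓘`-torsion, `𝓘(V)` finitely generated);
* `IsExtension.add/.smul/.zero`, `.restrict` — extensions form a submodule and restrict to extensions on
  principal opens;
* `exists_isExtension_of_affine` — **on an affine `V` there is `n` such that `a · s` extends for every
  `a ∈ 𝓘(V)ⁿ`** (numerators of `s` on the `D(gᵢ)`, made compatible by the torsion property, and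
  `𝓘(V)ⁿ ⊆ (gᵢ^{N})`, Mathlib `Ideal.exists_pow_le_of_le_radical_of_fg`);
* `exists_isExtension_basicOpen` — hence for `a ∈ 𝓘(D(h))ⁿ` on the principal opens `D(h) ⊆ V`.

Everything is proved; no named facts.

## References

* R. Hartshorne, *Algebraic Geometry* (1977): II Ex. 5.15, III Ex. 3.7. [Hartshorne1977]
* A. Grothendieck, EGA I (1960), 9.4.7; EGA III (1961), 3.1.3. [EGAIII1]
* U. Görtz, T. Wedhorn, *Algebraic Geometry I*, 2nd ed. (2020): Lemma 12.63 (iii), p. 437. [GortzWedhorn2020]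
-/

noncomputable section

open CategoryTheory CategoryTheory.Limits AlgebraicGeometry TopologicalSpace Opposite
open Literature.AlgebraicGeometry.Morphisms

universe u

namespace Literature.AlgebraicGeometry.Modules

variable {X : Scheme.{u}} (M : X.Modules) (I : X.IdealSheafData) {W₀ : X.Opens} (s : Γ(M, W₀))

/-- **`x` extends `a · s` to the affine `V`**: `x|_{D(g)} = a|_{D(g)} · s|_{D(g)}` for every `g ∈ 𝓘(V)`
(with `D(g) ⊆ W₀`). [folklore] -/
def IsExtension {V : X.Opens} (hV : IsAffineOpen V) (a : Γ(X, V)) (x : Γ(M, V)) : Prop :=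
  ∀ (g : Γ(X, V)), g ∈ I.ideal ⟨V, hV⟩ → ∀ (hg : X.basicOpen g ≤ W₀),
    M.presheaf.map (homOfLE (X.basicOpen_le g)).op x =
      X.presheaf.map (homOfLE (X.basicOpen_le g)).op a • M.presheaf.map (homOfLE hg).op s

variable {M I s}

namespace IsExtension

variable {V : X.Opens} {hV : IsAffineOpen V}

/-- Extensions add. [folklore] -/
theorem add {a a' : Γ(X, V)} {x x' : Γ(M, V)} (hx : IsExtension M I s hV a x)
    (hx' : IsExtension M I s hV a' x') : IsExtension M I s hV (a + a') (x + x') := by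
  intro g hg hgW
  rw [map_add, map_add, add_smul, hx g hg hgW, hx' g hg hgW]

/-- The zero section extends `0 · s`. [folklore] -/
theorem zero : IsExtension M I s hV 0 0 := by
  intro g hg hgW
  rw [map_zero, map_zero, zero_smul]

/-- Extensions are stable under the action of `Γ(V, 𝒪_X)`. [folklore] -/
theorem smul (c : Γ(X, V)) {a : Γ(X, V)} {x : Γ(M, V)} (hx : IsExtension M I s hV a x) :
    IsExtension M I s hV (c * a) (c • x) := by
  intro g hg hgW
  rw [Scheme.Modules.map_smul, map_mul, mul_smul, hx g hg hgW]

/-- If `a · s` vanishes wherever it is defined (e.g. `a` annihilates `M`), `0` extends it. [folklore] -/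
theorem zero_of_smul_eq_zero {a : Γ(X, V)}
    (ha : ∀ (g : Γ(X, V)), g ∈ I.ideal ⟨V, hV⟩ → ∀ (hg : X.basicOpen g ≤ W₀),
      X.presheaf.map (homOfLE (X.basicOpen_le g)).op a • M.presheaf.map (homOfLE hg).op s = 0) :
    IsExtension M I s hV a 0 := by
  intro g hg hgW
  rw [map_zero, ha g hg hgW]

end IsExtension

/-- **No `𝓘`-torsion implies no `𝓘ᶜ`-torsion.** [folklore] -/
theorem eq_zero_of_pow_smul_eq_zero {V : X.Opens} (hV : IsAffineOpen V)
    (htf : ∀ m : Γ(M, V), (∀ a ∈ I.ideal ⟨V, hV⟩, a • m = 0) → m = 0) :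
    ∀ (c : ℕ) (m : Γ(M, V)), (∀ a ∈ I.ideal ⟨V, hV⟩ ^ c, a • m = 0) → m = 0 := by
  intro c
  induction c with
  | zero => intro m hm; simpa using hm 1 (by rw [pow_zero, Ideal.one_eq_top]; trivial)
  | succ c ihc =>
    intro m hm
    apply ihc
    intro a ha
    apply htf
    intro b hb
    rw [smul_smul]
    exact hm _ (by rw [pow_succ']; exact Ideal.mul_mem_mul hb ha)

/-- **Extensions are unique** when `M` (affine-localizing) has no `𝓘`-torsion and `𝓘(V)` is finitely
generated. [cite: Hartshorne1977, II Ex. 5.15] -/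
theorem IsExtension.unique (hM : IsAffineLocalizing M) {V : X.Opens} {hV : IsAffineOpen V}
    (hfg : (I.ideal ⟨V, hV⟩).FG) (htf : ∀ m : Γ(M, V), (∀ a ∈ I.ideal ⟨V, hV⟩, a • m = 0) → m = 0)
    {a : Γ(X, V)} {x x' : Γ(M, V)} (hx : IsExtension M I s hV a x) (hx' : IsExtension M I s hV a x')
    (hIW₀ : ∀ g ∈ I.ideal ⟨V, hV⟩, X.basicOpen g ≤ W₀) : x = x' := by
  classical
  rw [← sub_eq_zero]
  set δ := x - x'
  -- each generator of `𝓘(V)` kills `δ` after a power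
  obtain ⟨G, hG⟩ := hfg
  have hkill : ∀ g ∈ G, ∃ L : ℕ, g ^ L • δ = 0 := by
    intro g hg
    have hgI : g ∈ I.ideal ⟨V, hV⟩ := hG ▸ Ideal.subset_span hg
    refine hM.torsion hV g δ (X.basicOpen_le g) le_rfl ?_
    rw [map_sub, hx g hgI (hIW₀ g hgI), hx' g hgI (hIW₀ g hgI), sub_self]
  choose! L hL using hkill
  -- `𝓘(V)ⁿ ⊆ (g^{L g})`, which kills `δ`
  have hrad : I.ideal ⟨V, hV⟩ ≤ (Ideal.span ((fun g => g ^ L g) '' (G : Set Γ(X, V)))).radical := by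
    rw [← hG, Ideal.span_le]
    intro g hg
    exact ⟨L g, Ideal.subset_span ⟨g, hg, rfl⟩⟩
  obtain ⟨n, hn⟩ := Ideal.exists_pow_le_of_le_radical_of_fg hrad ⟨G, hG⟩
  refine eq_zero_of_pow_smul_eq_zero hV htf n δ fun a ha => ?_
  refine Submodule.span_induction (p := fun a _ => a • δ = 0) ?_ ?_ ?_ ?_ (hn ha)
  · rintro _ ⟨g, hg, rfl⟩
    exact hL g hg
  · rw [zero_smul]
  · intro a b _ _ ha hb; rw [add_smul, ha, hb, add_zero]
  · intro c a _ ha; rw [smul_eq_mul, mul_smul, ha, smul_zero]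

/-- Principal opens lie in one another when the functions do: `D(gh) ⊆ D(g)`. [folklore] -/
theorem basicOpen_mul_le_left {V : X.Opens} (g h : Γ(X, V)) : X.basicOpen (g * h) ≤ X.basicOpen g := by
  rw [Scheme.basicOpen_mul]; exact inf_le_left

/-- `D(gh) ⊆ D(h)`. [folklore] -/
theorem basicOpen_mul_le_right {V : X.Opens} (g h : Γ(X, V)) : X.basicOpen (g * h) ≤ X.basicOpen h := by
  rw [Scheme.basicOpen_mul]; exact inf_le_right

/-- Restricting a "numerator equation" `y|_{D(p)} = r|_{D(p)} · s|_{D(p)}` further down to `C ⊆ D(p)`.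
[folklore] -/
theorem restrict_numerator_eq {V : X.Opens} {p : Γ(X, V)} (hp : X.basicOpen p ≤ W₀) {y : Γ(M, V)}
    {r : Γ(X, V)}
    (E : M.presheaf.map (homOfLE (X.basicOpen_le p)).op y =
      X.presheaf.map (homOfLE (X.basicOpen_le p)).op r • M.presheaf.map (homOfLE hp).op s)
    {C : X.Opens} (hC : C ≤ X.basicOpen p) :
    M.presheaf.map (homOfLE (hC.trans (X.basicOpen_le p))).op y =
      X.presheaf.map (homOfLE (hC.trans (X.basicOpen_le p))).op r •
        M.presheaf.map (homOfLE (hC.trans hp)).op s := by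
  have h := congrArg (M.presheaf.map (homOfLE hC).op) E
  rw [Scheme.Modules.map_smul, map_map, map_map, ringMap_map] at h
  refine (map_eq_map M _ _ y).trans (h.trans ?_)
  exact congrArg₂ (fun φ ψ => X.presheaf.map φ r • M.presheaf.map ψ s) (Subsingleton.elim _ _)
    (Subsingleton.elim _ _)

/-- Restricting the two sides of a would-be numerator equation down to `C ⊆ D(p)`. [folklore] -/
theorem restrict_sides_eq {V : X.Opens} {p : Γ(X, V)} (hp : X.basicOpen p ≤ W₀) (y : Γ(M, V))
    (r : Γ(X, V)) {C : X.Opens} (hC : C ≤ X.basicOpen p) :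
    M.presheaf.map (homOfLE hC).op (M.presheaf.map (homOfLE (X.basicOpen_le p)).op y -
      X.presheaf.map (homOfLE (X.basicOpen_le p)).op r • M.presheaf.map (homOfLE hp).op s) =
    M.presheaf.map (homOfLE (hC.trans (X.basicOpen_le p))).op y -
      X.presheaf.map (homOfLE (hC.trans (X.basicOpen_le p))).op r •
        M.presheaf.map (homOfLE (hC.trans hp)).op s := by
  rw [map_sub, Scheme.Modules.map_smul, map_map, map_map, ringMap_map]
  exact congrArg₂ (fun a b => a - b) (map_eq_map M _ _ y)
    (congrArg₂ (fun φ ψ => X.presheaf.map φ r • M.presheaf.map ψ s) (Subsingleton.elim _ _)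
      (Subsingleton.elim _ _))

/-- If `x ∈ D(g'')` and `g'' ∈ (G)`, then `x ∈ D(g'' g')` for some `g' ∈ G`. [folklore] -/
theorem exists_mem_basicOpen_mul {V : X.Opens} (G : Finset Γ(X, V)) {g'' : Γ(X, V)}
    (hg'' : g'' ∈ Ideal.span (G : Set Γ(X, V))) {x : X} (hx : x ∈ X.basicOpen g'') :
    ∃ g' ∈ G, x ∈ X.basicOpen (g'' * g') := by
  classical
  by_contra hno
  push Not at hno
  have hmem : ∀ g' ∈ Ideal.span (G : Set Γ(X, V)), x ∉ X.basicOpen (g'' * g') := by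
    intro g' hg'
    refine Submodule.span_induction (p := fun g' _ => x ∉ X.basicOpen (g'' * g')) hno ?_ ?_ ?_ hg'
    · rw [mul_zero, Scheme.basicOpen_zero]; exact id
    · intro b c _ _ hb hc hbc
      have hxV : x ∈ V := X.basicOpen_le _ hbc
      rw [mul_add, Scheme.mem_basicOpen (hx := hxV), map_add] at hbc
      exact (IsLocalRing.nonunits_add (mt (Scheme.mem_basicOpen X (g'' * b) x hxV).mpr hb)
        (mt (Scheme.mem_basicOpen X (g'' * c) x hxV).mpr hc)) hbc
    · intro c b _ hb hcb
      rw [smul_eq_mul, mul_left_comm, Scheme.basicOpen_mul] at hcb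
      exact hb hcb.2
  have := hmem g'' hg''
  rw [Scheme.basicOpen_mul] at this
  exact this ⟨hx, hx⟩

/-- **Existence of extensions on an affine open**: there is `n` such that `a · s` extends to `V` for
every `a ∈ 𝓘(V)ⁿ`. [cite: Hartshorne1977, II Ex. 5.15 / III Ex. 3.7] -/
theorem exists_isExtension_of_affine (hM : IsAffineLocalizing M) {V : X.Opens} (hV : IsAffineOpen V)
    (hfg : (I.ideal ⟨V, hV⟩).FG) (hIW₀ : ∀ g ∈ I.ideal ⟨V, hV⟩, X.basicOpen g ≤ W₀) :
    ∃ n : ℕ, ∀ a ∈ I.ideal ⟨V, hV⟩ ^ n, ∃ x : Γ(M, V), IsExtension M I s hV a x := by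
  classical
  obtain ⟨G, hG⟩ := hfg
  have hGI : ∀ g ∈ G, g ∈ I.ideal ⟨V, hV⟩ := fun g hg => hG ▸ Ideal.subset_span hg
  have hGW : ∀ g ∈ G, X.basicOpen g ≤ W₀ := fun g hg => hIW₀ g (hGI g hg)
  -- Step 1: numerators of `s` on the `D(g)`, `g ∈ G` (powers kept inside the restriction)
  have hnum : ∀ g (hg : g ∈ G), ∃ (N : ℕ) (y : Γ(M, V)),
      M.presheaf.map (homOfLE (X.basicOpen_le g)).op y =
        X.presheaf.map (homOfLE (X.basicOpen_le g)).op (g ^ N) •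
          M.presheaf.map (homOfLE (hGW g hg)).op s := by
    intro g hg
    obtain ⟨N, y, hy⟩ := hM.numerator hV g rfl (M.presheaf.map (homOfLE (hGW g hg)).op s)
    exact ⟨N, y, by rw [map_pow]; exact hy⟩
  choose! N y hy using hnum
  -- Step 2: compatibility on the other `D(g')`, after a power of `g`
  have hcomp : ∀ g (hg : g ∈ G) g' (hg' : g' ∈ G), ∃ L : ℕ,
      X.presheaf.map (homOfLE (X.basicOpen_le g')).op g ^ L •
        (M.presheaf.map (homOfLE (X.basicOpen_le g')).op (y g) -
          X.presheaf.map (homOfLE (X.basicOpen_le g')).op (g ^ N g) •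
            M.presheaf.map (homOfLE (hGW g' hg')).op s) = 0 := by
    intro g hg g' hg'
    refine hM.torsion (hV.basicOpen g') (X.presheaf.map (homOfLE (X.basicOpen_le g')).op g) _
      (W := X.basicOpen (g' * g)) (basicOpen_mul_le_left g' g)
      (by rw [Scheme.basicOpen_res, Scheme.basicOpen_mul]) ?_
    rw [restrict_sides_eq (hGW g' hg') (y g) (g ^ N g) (basicOpen_mul_le_left g' g), sub_eq_zero]
    have h1 := restrict_numerator_eq (hGW g hg) (hy g hg) (basicOpen_mul_le_right g' g)
    refine (map_eq_map M _ _ (y g)).trans (h1.trans ?_)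
    exact congrArg₂ (fun φ ψ => X.presheaf.map φ (g ^ N g) • M.presheaf.map ψ s) (Subsingleton.elim _ _)
      (Subsingleton.elim _ _)
  choose! L hL using hcomp
  -- Step 3: uniform exponents; corrected numerators `y' g := g^Lm • y g`
  set Lm : ℕ := G.sup fun g => G.sup (L g) with hLm
  have hy' : ∀ g (hg : g ∈ G) g' (hg' : g' ∈ G),
      M.presheaf.map (homOfLE (X.basicOpen_le g')).op (g ^ Lm • y g) =
        X.presheaf.map (homOfLE (X.basicOpen_le g')).op (g ^ (N g + Lm)) •
          M.presheaf.map (homOfLE (hGW g' hg')).op s := by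
    intro g hg g' hg'
    have hLle : L g g' ≤ Lm := (Finset.le_sup hg' : L g g' ≤ G.sup (L g)).trans
      (Finset.le_sup (f := fun g => G.sup (L g)) hg)
    have key := hL g hg g' hg'
    rw [smul_sub, sub_eq_zero, smul_smul, map_pow, ← pow_add] at key
    -- key : g|^L • y| = g|^(L + N) • s|
    rw [Scheme.Modules.map_smul, map_pow, map_pow, ← pow_sub_mul_pow _ hLle, mul_smul, key, smul_smul,
      ← pow_add]
    congr 2
    omega
  -- Step 4: `𝓘(V)ⁿ ⊆ (g^{N g + Lm} : g ∈ G)`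
  have hrad : I.ideal ⟨V, hV⟩ ≤ (Ideal.span ((fun g => g ^ (N g + Lm)) '' (G : Set Γ(X, V)))).radical := by
    rw [← hG, Ideal.span_le]
    intro g hg
    exact ⟨N g + Lm, Ideal.subset_span ⟨g, hg, rfl⟩⟩
  obtain ⟨n, hn⟩ := Ideal.exists_pow_le_of_le_radical_of_fg hrad ⟨G, hG⟩
  refine ⟨n, fun a ha => ?_⟩
  -- Step 5: the generators `g^{N g + Lm}` have the extensions `g^Lm • y g`
  have hgen : ∀ g (hg : g ∈ G), IsExtension M I s hV (g ^ (N g + Lm)) (g ^ Lm • y g) := by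
    intro g hg g'' hg'' hg''W
    -- compare on the cover of `D(g'')` by the `D(g'' g')`, `g' ∈ G`
    let K : Type u := {g' // g' ∈ G}
    have hcov : X.basicOpen g'' ≤ ⨆ k : K, X.basicOpen (g'' * k.1) := by
      intro x hx
      obtain ⟨g', hg', hx'⟩ := exists_mem_basicOpen_mul G (hG ▸ hg'') hx
      exact Opens.mem_iSup.mpr ⟨⟨g', hg'⟩, hx'⟩
    apply (abSheafOf M).eq_of_locally_eq' (fun k : K => X.basicOpen (g'' * k.1)) (X.basicOpen g'')
      (fun k => homOfLE (basicOpen_mul_le_left g'' k.1)) hcov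
    intro k
    obtain ⟨g', hg'⟩ := k
    change M.presheaf.map (homOfLE (basicOpen_mul_le_left g'' g')).op _ =
      M.presheaf.map (homOfLE (basicOpen_mul_le_left g'' g')).op _
    have e1 := restrict_sides_eq (M := M) (s := s) hg''W (g ^ Lm • y g) (g ^ (N g + Lm))
      (basicOpen_mul_le_left g'' g')
    rw [← sub_eq_zero, ← map_sub, e1, sub_eq_zero]
    refine (map_eq_map M _ _ _).trans ((restrict_numerator_eq (hGW g' hg') (hy' g hg g' hg')
      (basicOpen_mul_le_right g'' g')).trans ?_)
    exact congrArg₂ (fun φ ψ => X.presheaf.map φ (g ^ (N g + Lm)) • M.presheaf.map ψ s)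
      (Subsingleton.elim _ _) (Subsingleton.elim _ _)
  -- Step 6: span induction
  have hspan : ∀ a ∈ Ideal.span ((fun g => g ^ (N g + Lm)) '' (G : Set Γ(X, V))),
      ∃ x : Γ(M, V), IsExtension M I s hV a x := by
    intro a ha
    refine Submodule.span_induction (p := fun a _ => ∃ x : Γ(M, V), IsExtension M I s hV a x)
      ?_ ?_ ?_ ?_ ha
    · rintro _ ⟨g, hg, rfl⟩
      exact ⟨_, hgen g hg⟩
    · exact ⟨0, IsExtension.zero⟩
    · rintro a b - - ⟨x, hx⟩ ⟨x', hx'⟩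
      exact ⟨x + x', hx.add hx'⟩
    · rintro c a - ⟨x, hx⟩
      exact ⟨c • x, hx.smul c⟩
  exact hspan a (hn ha)

end Literature.AlgebraicGeometry.Modules

end
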